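import Mathlib
import HarnessLib
import HarnessLib.Audit
import Summits.AtomisticToContinuum.Statement
import Literature.MathematicalPhysics.StatisticalMechanics.LennardJonesClusters
import HarnessLib.Audit.Status.Attr

/-!
Route: CrystalThreeCone

CLOSED (retired) 2026-08-15T13:41:30Z by operator:999:1257524 — reason: not-a-thesis: assembly does not conclude the sub-problem Statement — note: D-0027 §2.1 audit (human 2026-08-15: routes that do not decide the summit are removed): the assembly concludes `Literature.MathematicalPhysics.StatisticalMechanics.Crystallization`, not the sub-problem statement; a NEW conforming route may be opened from the same idea (generated `closes : … → _root_. The file is kept as the record of this route; refuted decls are indexed as negative knowledge (`ledger negatives`).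

# Route CrystalThreeCone — three-cone certificate V_LJ = g + U + f (certified bounded-range part,
slack, positive-type tail) with an LP-chosen split

X = ExactCertificate ("it suffices to exhibit an exact three-cone certificate"): a periodic
configuration P of ℝ³
(expected: relaxed hcp, nearest-neighbour distance a* ≈ 0.9712), a range ρ < ∞, a constant c and a
split of the Lennard-Jones
potential V_LJ = g + U + f on (0,∞) such that (1) g vanishes on [ρ,∞) and is c-STABLE on all finite
configurations of distinct
points (Σ_{i<j} g ≥ −cN; to be certified by a fair-share one-centre inequality of kissing heritage),
(2) U ≥ 0 (slack cone),
(3) f is of positive type on ℝ³ as a radial function (Bochner cone: all finite quadratic forms Σ w_i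
w_j f(|y_i − y_j|) ≥ 0), and
(4) c + f(0)/2 = −e(P). Realises card three-cone-certificate. Then E_N(x) ≥ N·e(P) for EVERY N and
configuration (KeplerBound:
the optimal LJ stability constant is a periodic energy per particle), whence conjunct (i) with the
trial-state upper bound; and
the three slacks of energy-near-optimal configurations are o(N), which is the mechanism behind
SlackRigidity ⇒ BulkDefectVanish ⇒
conjunct (ii) through the shared soft assembly lemma (items 0751/0752 of CrystalKissingRigidity).
Lean: `∃ (P : Literature.MathematicalPhysics.StatisticalMechanics.PeriodicConfiguration 3) (ρ c : ℝ)
(g U f : ℝ → ℝ), (∀ r : ℝ, 0 < r → Literature.MathematicalPhysics.StatisticalMechanics.lennardJones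
r = g r + U r + f r) ∧ (∀ r : ℝ, 0 < r → 0 ≤ U r) ∧ (∀ r : ℝ, ρ ≤ r → g r = 0) ∧ (∀ (n : ℕ) (y : Fin
n → EuclideanSpace ℝ (Fin 3)) (w : Fin n → ℝ), 0 ≤ ∑ i, ∑ j, w i * w j * f (dist (y i) (y j))) ∧ (∀
(N : ℕ) (x : Fin N → EuclideanSpace ℝ (Fin 3)), Function.Injective x → -(c * (N : ℝ)) ≤
Literature.MathematicalPhysics.StatisticalMechanics.interactionEnergy g x) ∧ c + f 0 / 2 =
-(P.energyPerParticle Literature.MathematicalPhysics.StatisticalMechanics.lennardJones)`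

## Assembly
Pure plumbing (sorry-free `Assembly_provable` in Sketch.lean): CertificateBound turns
ExactCertificate into KeplerBound; EnergeticHalf
with TrialStateUpper gives HasPeriodicGroundStateEnergy; SlackToBulk turns SlackRigidity into
BulkDefectVanish; DefectVanishCrystallizes
with the discharged fact LennardJonesMinimalDistance_holds gives IsCrystallizing; the pair is
Crystallization. NoGap is not an
antecedent: it is the necessary condition (given TrialStateUpper) whose refutation closes the line
cheaply.

Rationale: WHY THIS LINE. Fisher–Ruelle's stability criterion (Ruelle1969 §3.2.6–3.2.8, Prop. 3.2.7: Φ = Φ₁ +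
Φ₂ with Φ₁ ≥ 0 and Φ₂ of positive type ⇒
Σ_{i<j} Φ ≥ −N Φ₂(0)/2) is a TWO-cone certificate that is never sharp for Lennard-Jones; the card
adds a third cone — a
bounded-range part g whose optimal stability constant is a FINITE certified computation (one-centre
star inequality at radius
ρ ≈ 1.85 r₀, Newton–Gregory/Hales heritage: Hales2012, flyspeck_L12 in tree) — and lets a linear
program decide who pays what:
geometry pays the well (67 % of |e*| is first-shell energy), Bochner pays the smooth r⁻⁶ tail, slack
absorbs the rest. Imported
areas: LP/SDP duality for point configurations (CohnKumar2006 §9 Prop. 31; CohnLaatSalmon2022 for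
the 3-point escalation; Li2022 =
the measured failure of the PURE two-point ray in d = 3, in tree as Li2022_cohnElkies3D), classical
stability theory (Ruelle1969;
the rigorous window 8.61 ≤ B_LJ ≤ 14.316 of DelimaProcacciYuhjtman2015 p.15 / Yuhjtman2015, which
KeplerBound would close at
8.611), certified interval computation (Flyspeck-lite). What it does that the open routes do not:
CrystalLocalRigidity (0620/0625)
needs a local inequality sharp INCLUDING the tail (truncation radius R → ∞, no α-localisation is
available for LJ:
LocalizedPotentialsExcludeLennardJones); here the tail is paid exactly and linearly by f, so the
certified local problem shrinks to
radius ρ and need only be sharp modulo cone(U) + cone(f); CrystalKissingRigidity's K1/K2 (soft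
twelve-coordination, robust Fejes
Tóth) become consequences of complementary slackness instead of inputs. Negatives index: empty for
this summit at filing.

RANKED CRUXES. #2 NoGap (crux) — NO DUALITY GAP at range 9/5 (card item C1, the cheap kill test, to
be explored numerically first): for every ε > 0 there is a split V_LJ = g + U + f on (0,∞) with U ≥
0, g ≡ 0 on [9/5,∞), f of positive type (finite quadratic forms), g c-stable on all finite
configurations of distinct points, whose certificate value −(c + f(0)/2) comes within ε of E(N)/N
for some N ≥ 1 (certificate values are ≤ E(N)/N for all N automatically, so this says sup of values
= e_∞ = inf_N E(N)/N). ρ = 9/5 r₀ ≈ 1.853 a* sits between the √3·a* and √(11/3)·a* shells of hcp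
(38/42 neighbours for the two Barlow environments); the range is a dial — a refutation at 9/5 with
no-gap numerics at ρ = 2 sends the route to tenure, not to the grave. [difficulty: L] (why it might
fail: A Li2022-type duality gap may survive moving the core into g: the positive-type cone must pay
the r⁻⁶ tail to stacking resolution (e(fcc) − e(hcp) ≈ 7e-5) with f ≤ V beyond 9/5 and f̂ → 0 on
hcp's Bragg set incl. k = 0; a three-cone phantom pair measure with value < e_∞ refutes it.)
[Li2022, CohnKumar2006, Ruelle1969, DelimaProcacciYuhjtman2015, Yuhjtman2015, CohnLaatSalmon2022]
#3 ExactCertificate (crux) — the thesis X (card items C2 + C3 merged into one existence statement):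
an EXACT three-cone certificate exists — P periodic, ρ < ∞, c, g, U, f with V_LJ = g + U + f on
(0,∞), U ≥ 0, g ≡ 0 on [ρ,∞), f of positive type, g c-stable, and c + f(0)/2 = −e(P). Finite ρ is
the content: with ρ = ∞ (g = V_LJ, U = f = 0) the statement collapses to KeplerBound; at finite ρ it
says the tail beyond ρ can be paid EXACTLY by Bochner + slack (Cohn–Kumar-type interpolation: f ≤ V
on [ρ,∞) with equality on D_P ∩ [ρ,∞), f̂ vanishing against P's structure factor on the Bragg set
and at 0 — zero pressure ⇒ ∫f = 0), while hcp(a*) is simultaneously a ground state of the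
finite-range g, certified by a one-centre inequality. [deps: NoGap] [difficulty: open-problem] (why
it might fail: Exactness = triple complementary slackness at hcp(a*): ground state of the
finite-range g among ALL configurations (finite-range 3-D crystallization, open), of f (f̂·S = 0 on
Bragg(hcp), ∫f = 0), and U = 0 on D_hcp; any one may be infeasible at every finite ρ, and c(g) is
Flyspeck-scale.) [CohnKumar2006, CohnEtAl2019, Li2022, FlatleyTheil2015, Hales2012, Ruelle1969,
BlancLewin2015]
#4 SlackRigidity (crux) — SLACK RIGIDITY (card item C4, typed at the level the certificate
delivers): there is ONE periodic configuration P (the LJ-optimal hcp, 0 ∈ P) such that for every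
window radius R and tolerance ε, along every sequence of injective configurations x^N whose energy
excess over the ground-state energy is o(N), all but o(N) particles i admit a linear isometry A with
the particles in B_R(x_i) ε-matched both ways to x_i + A(P ∩ B_R). Mechanism: with an exact
certificate the three slacks Σ U(r_ij), E_g + cN, Σ_{i,j} f(x_i − x_j) of such a sequence are o(N);
stability of the three equality cases (near-Barlow ρ-environments at all but o(N) particles; pair
distances on D_hcp; structure factor on Bragg(hcp)) plus layer propagation and Hägg selection
(shared 0737/0670) give the matching. Specialised to ground states (excess 0) it is exactly
BulkDefectVanish (0751). [deps: ExactCertificate] [difficulty: XL] (why it might fail: Needs a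
unique periodic minimiser up to isometry with coercive stability: an exact polytype tie, an
aperiodic optimal stacking (Hägg margin ~1e-4, J₂ ≈ −7.3e-5 uncertified), or soft o(N)-cost /
O(1)-displacement modes break it; as typed P must be vertex-transitive (hcp, fcc are).)
[BlancLewin2015, PartayOrtnerCsanyi2017, Stillinger2001, FlatleyTheil2015, Hales2012]
#9 KeplerBound (support) — KEPLER BOUND FOR LENNARD-JONES (finite-N energetic statement, the
certificate's output stripped of g, U, f): some periodic P has N·e(P) ≤ E_N(x) for every N and every
configuration x of N distinct points — equivalently B_LJ = −e(P): the optimal stability constant is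
a periodic energy per particle (expected 8.611 in ε-units = 0.7176 in tree units). A by-product
other routes may want; here it follows from ExactCertificate in ten lines (CertificateBound).
[difficulty: open-problem] [DelimaProcacciYuhjtman2015, Yuhjtman2015, BlancLewin2015]
#9 CertificateBound (support) — glue: an exact certificate gives the Kepler bound — U-cone ≥ 0
termwise, the Bochner form with w ≡ 1 gives 2Σ_{i<j} f ≥ −N f(0) (diagonal = f(0);
two_mul_interactionEnergy_eq_sum_offDiag in tree), g-stability gives Σ_{i<j} g ≥ −cN; add and use c
+ f(0)/2 = −e(P). [difficulty: provable-now] [Ruelle1969]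
#9 TrialStateUpper (support) — TRIAL-STATE UPPER BOUND per periodic configuration: for every
periodic Q and ε > 0, eventually E(N)/N ≤ e(Q) + ε (finite blocks of Q as N-point trial states:
boundary O(N^{2/3}) particles lose O(1) each since site energies are bounded by the summable r⁻⁶
tail, hasSum_lennardJones_dist_three in tree). Implies 0629 (limsup ≤ ⨅) by le_ciInf without any
BddBelow hypothesis. [difficulty: M] [BlancLewin2015]
#9 EnergeticHalf (support) — glue: KeplerBound + TrialStateUpper ⇒ conjunct (i): from N e(P) ≤
E_N(x) get e(P) ≤ E(N)/N for N ≥ 1 (le_ciInf over the non-empty injective configurations,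
nonempty_injective_config in tree); with TrialStateUpper at Q = P, E(N)/N → e(P); at general Q, e(P)
≤ e(Q) + ε for all ε, so P IsLeast. [difficulty: provable-now] [BlancLewin2015]
#9 BulkDefectVanish (support) — shared with CrystalKissingRigidity (item 0751, identical signature):
BULK DEFECT VANISHING for LJ ground states w.r.t. one periodic P. In this route it is the
specialisation of SlackRigidity to ground states (SlackToBulk) and stays claimable directly.
[difficulty: XL] [Hales2012, BlancLewin2015]
#9 SlackToBulk (support) — glue (five lines, sorry-free in Sketch.lean): a ground state is injective
with zero energy excess, so SlackRigidity specialises to BulkDefectVanish. [difficulty: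
provable-now] [BlancLewin2015]
#9 DefectVanishCrystallizes (support) — shared with CrystalKissingRigidity (item 0752, identical
signature): SOFT ASSEMBLY LEMMA — BulkDefectVanish and the uniform minimal distance of LJ ground
states (LennardJonesMinimalDistance, discharged in tree) give IsCrystallizing: good particles i_k as
origins, compactness of O(3) for the isometries, minimal distance makes the ε-matching a local
bijection, vague limits via tendsto_sum_of_eventually_near (CrystallizationLocalLimit in tree).
[difficulty: M] [BlancLewin2015]

TWO-LAYER PLAN. Foreseen glued splits, filed only after NoGap's numerics fix the split (g, U, f):
ExactCertificate ⇐ LocalConstant (the certified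
one-centre fair-share inequality for the LP's g at radius ρ, equality exactly at the two Barlow
environments) → TailInterpolant (a
positive-type f with f ≤ V_LJ on [ρ,∞), equality on D_hcp ∩ [ρ,∞), f̂·S_hcp = 0 on the Bragg set, ∫f
= 0) → ExactCertificate;
SlackRigidity ⇐ ConeStability (δ-slack ⇒ ε-near-Barlow ρ-environments at all but o(N) particles) →
LayersAndHagg (propagation to
Barlow fragments + stacking selection through shared 0737/0670) → SlackRigidity. k ≤ 3 each, depth
1.

KILL CRITERIA. (1) NoGap refuted at ρ = 9/5 by a certified three-cone phantom (a pair measure that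
is a mixture of genuine cluster pair statistics
below 9/5 and of positive type globally, with ∫V against it < e(hcp) − 1e-3·|e*|) together with
numerics showing the gap persists at
ρ = 2 and 5/2: close the route refuted:NoGap and record the by-product (the LP-optimal certifiable
split = best available route to
B_LJ < 14.316). (2) ExactCertificate refuted structurally — e.g. no positive-type radial f can
satisfy f ≤ V_LJ on [ρ,∞) with
equality on D_hcp ∩ [ρ,∞) and ∫f = 0, for any ρ — closes the route. (3) SlackRigidity refuted by an
exact energy tie between
non-isometric periodic minimisers or by an aperiodic optimal stacking: drop the positional half to
the shared items (0751 via other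
mechanisms); the energetic half survives. (4) 0627 refuted (route RefuteCrystalPeriodicMin
succeeds): the conjunct is dead and every
route with it.

NOT DECOMPOSED YET. The form of the one-centre inequality (fair-share weights, symmetry reduction,
interval arithmetic over ≤ 56-point environments,
FTTT-style 12-cap computation as template) — meaningless before the LP fixes g; the design of f
(Bragg-zero interpolation without
modular forms; hcp vs fcc separated by the reflections (10·ℓ), ℓ odd, and by U at the fcc-only
distance 2√2·a); the quantitative
stability of the three equality cases feeding SlackRigidity; virial (V ↦ V + λ rV′) and Mecke–Euler
cuts and the 3-point SDP
escalation (CohnLaatSalmon2022, exact rounding à la de Laat–Leijenhorst) if the plain three-cone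
value shows a small gap; surface
N^{2/3} constants (not needed: all statements are o(N)).

CHEAPEST FALSIFIER. One kit job (not runnable from this compute-free hub by a planner; the refuter
submits it): discretise f(r) = Σ_k μ_k sin(kr)/(kr),
μ_k ≥ 0 on a k-grid (≤ 40 nodes) plus the exact matching of the −r⁻⁶/6 tail, U ≥ 0 on an r-grid of
(0, 3], g := V − U − f on
(0, 9/5]; estimate c(g) by multistart minimisation of E_g/N over clusters N ≤ 60 and over dilated
hcp/fcc/bcc/icosahedral-shell
families (a LOWER estimate of the true c, so the LP value is optimistic); solve max −c − f(0)/2 by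
cutting planes; compare with
|e(hcp)| = 0.71759. An optimistic value below 0.710 (gap ≥ 1 %) files suspect-false on NoGap at
once; a value within 1e-3 triggers
the certified programme. Lookup already done: no LP-optimised Fisher–Ruelle split for LJ exists in
print (DelimaProcacciYuhjtman2015
§5.3 optimises Basuev's split for the Mayer radius only).

NUMBERS. Tree units V_LJ = r⁻¹²/12 − r⁻⁶/6 (= ε-units/12). Lattice sums (Stillinger2001): hcp L₆ =
14.45489, L₁₂ = 12.13229; fcc L₆ =
14.45392, L₁₂ = 12.13188; e = −L₆²/(24 L₁₂): e(hcp) = −0.71759, e(fcc) = −0.71752 (Δ ≈ 7e-5 ≈ |J₂|);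
a* = (L₁₂/L₆)^{1/6} = 0.9712.
Shell budget of e(hcp): 6V(a*) = −0.4817 (67.1 %), 3V(√2a*) = −0.0689, V(√(8/3)a*) = −0.0101,
9V(√3a*) = −0.0647; inside ρ = 9/5:
−0.6255 (87.2 %), tail beyond 9/5: −0.0921 (12.8 %) — the minimum f must pay. Rigorous stability
window 8.61 ≤ B_LJ ≤ 14.316
(ε-units; DelimaProcacciYuhjtman2015 p.15, Yuhjtman2015) vs conjectured B_LJ = 8.611 = 12 × 0.71759.
Pure two-point LP in d = 3:
packing bound > 0.18398 vs Kepler 0.17678 (Li2022; tree d3_constants_ordered). Minimal distance of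
LJ ground states δ = 1/3 (tree).

DEFINITION REQUESTS. None: positive type is inlined as the finite quadratic-form condition
(Ruelle1969 (2.18)), which is all the assembly uses; no
Fourier transform, Schwartz class or Bragg set enters a filed statement. Cite facts wanted later
(layer 2): certified lattice sums
L₆, L₁₂ for hcp/fcc (Stillinger2001) and the interlayer couplings J_k (shared item 0670).

Novelty: Searches (2026-08-15): lit search --hybrid "stability constant Lennard-Jones positive definite
decomposition lower bound ground state
energy per particle" (10 book hits; Ruelle1969 pp. 37–38 = §3.2.6–3.2.8 opened with lit read: Prop.
3.2.7 two-cone criterion,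
footnote 9 "open problem to construct a stable potential not of the form (2.19)"); lit search
--hybrid "decomposition of the pair
potential into a positive part and a function of positive type stability estimate Ruelle" (8 hits,
Ruelle1969/Lenard1973/GlimmJaffe,
all stability-only); lit search zbmath "stability constant Lennard-Jones potential lower bound" (2
hits: doi:10.1007/s00220-015-2529-z,
doi:10.1007/s10955-015-1300-3; arXiv:1503.04221 read, p.15 "8.61 ≤ B_LJ ≤ 14.316", §5.3 optimises
Basuev's split for the Mayer
radius only); zbmath "linear programming bounds point configurations energy Cohn Kumar" (1 hit,
doi:10.1007/978-0-387-84808-2);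
OpenAlex/S2/arXiv APIs rate-limited today (HTTP 429) — covered by the card's two novelty audits
(refuter-2, refuter-13, 2026-08-15:
Torquato–Stillinger duality arXiv:0710.5315/1009.1601 read, Cohn–Kumar PNAS 2009 hybrid LP +
enumeration on spheres with the
Euclidean case posed open p.10, Yuhjtman2015 one-centre + minimal distance).
Nearest prior art found: Ruelle1969 Prop. 3.2.7–3.2.8 (the (U,f) two-cone bound, stability only);
CohnKumar2006 §9 Prop. 31
(Bochner-ray LP for energy at fixed density; universal optimality); Li2022 arXiv:2206.09876 (duality
gap of the pure two-point r  [refs: 10.1007/s00220-015-2529-z, 10.1007/s10955-015-1300-3, 10.1007/978-0-387-84808-2, 1503.04221, 0710.5315, 2206.09876, doi:10.1007/s00220-015-2529-z, doi:10.1007/s10955-015-1300-3, doi:10.1007/978-0-387-84808-2, Ruelle1969, Yuhjtman2015, CohnKumar2006, Li2022, DelimaProcacciYuhjtman2015]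

Barriers (technique_class: hybrid-lp-certificate, bochner-tail, one-centre-inequality): - technique_class: hybrid-lp-certificate, bochner-tail, one-centre-inequality
- Literature.Barriers.AtomisticToContinuum.Li2022_cohnElkies3D: applies to the pure two-point
Fourier ray only (f alone cannot even certify Kepler: every Cohn–Elkies value > 0.18398 > 0.17678);
evaded by moving the steep first-shell part off the Fourier side into g, certified geometrically
(the class of argument that did prove Kepler); a residual gap on the tail is exactly crux NoGap —
honest form: it may not evade it; the bet is that the whole d = 3 gap lives in the core.
- Literature.Barriers.AtomisticToContinuum.NoUniversallyOptimalLattice3D: no universality is claimed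
— one potential, zero pressure, and the target is the non-lattice hcp with its structure-factor
extinctions handled inside f̂; fcc is allowed (indeed required) to be f- or U-suboptimal.
- Literature.Barriers.AtomisticToContinuum.TetrahedralFrustration: applies to raw single-cell local
functionals (TetrahedralFrustrationNarrow); the local part here is a one-centre STAR inequality at
radius ρ ≈ 1.85 r₀ (second and third shells priced) that must be sharp only modulo cone(U) +
cone(f); the bet — unproved — is that the tetrahedral/icosahedral local gain at that radius is
smaller than what U and f absorb, else Marchal-type reapportioning (Flyspeck scale) is needed for
c(g).
- Literature.Barriers.AtomisticToContinuum.KissingTwelveDegeneracy: g is stacking-blind by design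
(both Barlow environments are equality cases, consistent with ShortR

History (route lifecycle, newest last):
- 2026-08-15T13:41:34Z · CLOSED retired — not-a-thesis: assembly does not conclude the sub-problem Statement (operator:999:1257524)

sub-problem: Crystallization · status: closed(retired) · opened planner-plancard-AtomisticToContinuum-Crystal-323919f5-0 2026-08-15T11:11:25Z · rev 0 · ledger route-AtomisticToContinuum-CrystalThreeCone
GENERATED by the gate from the ledger (D-0016/17). Provers cite these decls: `theorem foo : Summit.AtomisticToContinuum.Crystallization.Theses.CrystalThreeCone.<Decl> := …` in Summits/AtomisticToContinuum/Crystallization/Theorems/<Name>.lean.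
-/

namespace Summit.AtomisticToContinuum.Crystallization.Theses.CrystalThreeCone

open scoped BigOperators Topology Manifold Classical MeasureTheory ProbabilityTheory Matrix InnerProductSpace ComplexConjugate ContinuousMap
open Filter Set Function TopologicalSpace MeasureTheory

attribute [summit_statement] _root_.Crystallization

/-- item stmt-AtomisticToContinuum-3099 · crux · rank 2 · closed · moot by None · by planner
why it might fail: A Li2022-type duality gap may survive moving the core into g: the positive-type cone must pay the r⁻⁶ tail to stacking resolution (e(fcc) − e(hcp) ≈ 7e-5) with f ≤ V beyond 9/5 and f̂ → 0 on hcp's Bragg set incl. k = 0; a three-cone phantom pair measure with value < e_∞ refutes it.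
sources: Li2022, CohnKumar2006, Ruelle1969, DelimaProcacciYuhjtman2015, Yuhjtman2015, CohnLaatSalmon2022
[crux] NO DUALITY GAP at range 9/5 (card item C1, the cheap kill test, to be explored numerically
first): for every ε > 0 there is a split V_LJ = g + U + f on (0,∞) with U ≥ 0, g ≡ 0 on [9/5,∞), f
of positive type (finite quadratic forms), g c-stable on all finite configurations of distinct
points, whose certificate value −(c + f(0)/2) comes within ε of E(N)/N for some N ≥ 1 (certificate
values are ≤ E(N)/N for all N automatically, so this says sup of values = e_∞ = inf_N E(N)/N). ρ =
9/5 r₀ ≈ 1.853 a* sits between the √3·a* and √(11/3)·a* shells of hcp (38/42 neighbours for the two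
Barlow environments); the range is a dial — a refutation at 9/5 with no-gap numerics at ρ = 2 sends
the route to tenure, not to the grave. [difficulty: L] -/
@[route_item "route-AtomisticToContinuum-CrystalThreeCone"]
def NoGap : Prop :=
  ∀ ε : ℝ, 0 < ε → ∃ (c : ℝ) (g U f : ℝ → ℝ), (∀ r : ℝ, 0 < r → Literature.MathematicalPhysics.StatisticalMechanics.lennardJones r = g r + U r + f r) ∧ (∀ r : ℝ, 0 < r → 0 ≤ U r) ∧ (∀ r : ℝ, 9 / 5 ≤ r → g r = 0) ∧ (∀ (n : ℕ) (y : Fin n → EuclideanSpace ℝ (Fin 3)) (w : Fin n → ℝ), 0 ≤ ∑ i, ∑ j, w i * w j * f (dist (y i) (y j))) ∧ (∀ (N : ℕ) (x : Fin N → EuclideanSpace ℝ (Fin 3)), Function.Injective x → -(c * (N : ℝ)) ≤ Literature.MathematicalPhysics.StatisticalMechanics.interactionEnergy g x) ∧ ∃ N : ℕ, 0 < N ∧ Literature.MathematicalPhysics.StatisticalMechanics.groundStateEnergy Literature.MathematicalPhysics.StatisticalMechanics.lennardJones 3 N / N ≤ -(c + f 0 / 2) + ε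

/-- item stmt-AtomisticToContinuum-3100 · crux · rank 3 · closed · moot by None · by planner
why it might fail: Exactness = triple complementary slackness at hcp(a*): ground state of the finite-range g among ALL configurations (finite-range 3-D crystallization, open), of f (f̂·S = 0 on Bragg(hcp), ∫f = 0), and U = 0 on D_hcp; any one may be infeasible at every finite ρ, and c(g) is Flyspeck-scale.
sources: CohnKumar2006, CohnEtAl2019, Li2022, FlatleyTheil2015, Hales2012, Ruelle1969
[crux] the thesis X (card items C2 + C3 merged into one existence statement): an EXACT three-cone
certificate exists — P periodic, ρ < ∞, c, g, U, f with V_LJ = g + U + f on (0,∞), U ≥ 0, g ≡ 0 on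
[ρ,∞), f of positive type, g c-stable, and c + f(0)/2 = −e(P). Finite ρ is the content: with ρ = ∞
(g = V_LJ, U = f = 0) the statement collapses to KeplerBound; at finite ρ it says the tail beyond ρ
can be paid EXACTLY by Bochner + slack (Cohn–Kumar-type interpolation: f ≤ V on [ρ,∞) with equality
on D_P ∩ [ρ,∞), f̂ vanishing against P's structure factor on the Bragg set and at 0 — zero pressure
⇒ ∫f = 0), while hcp(a*) is simultaneously a ground state of the finite-range g, certified by a
one-centre inequality. [deps: NoGap] [difficulty: open-problem] -/
@[route_item "route-AtomisticToContinuum-CrystalThreeCone", crux]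
def ExactCertificate : Prop :=
  ∃ (P : Literature.MathematicalPhysics.StatisticalMechanics.PeriodicConfiguration 3) (ρ c : ℝ) (g U f : ℝ → ℝ), (∀ r : ℝ, 0 < r → Literature.MathematicalPhysics.StatisticalMechanics.lennardJones r = g r + U r + f r) ∧ (∀ r : ℝ, 0 < r → 0 ≤ U r) ∧ (∀ r : ℝ, ρ ≤ r → g r = 0) ∧ (∀ (n : ℕ) (y : Fin n → EuclideanSpace ℝ (Fin 3)) (w : Fin n → ℝ), 0 ≤ ∑ i, ∑ j, w i * w j * f (dist (y i) (y j))) ∧ (∀ (N : ℕ) (x : Fin N → EuclideanSpace ℝ (Fin 3)), Function.Injective x → -(c * (N : ℝ)) ≤ Literature.MathematicalPhysics.StatisticalMechanics.interactionEnergy g x) ∧ c + f 0 / 2 = -(P.energyPerParticle Literature.MathematicalPhysics.StatisticalMechanics.lennardJones)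

/-- item stmt-AtomisticToContinuum-3101 · crux · rank 4 · closed · moot by None · by planner
why it might fail: Needs a unique periodic minimiser up to isometry with coercive stability: an exact polytype tie, an aperiodic optimal stacking (Hägg margin ~1e-4, J₂ ≈ −7.3e-5 uncertified), or soft o(N)-cost / O(1)-displacement modes break it; as typed P must be vertex-transitive (hcp, fcc are).
sources: BlancLewin2015, PartayOrtnerCsanyi2017, Stillinger2001, FlatleyTheil2015, Hales2012
[crux] SLACK RIGIDITY (card item C4, typed at the level the certificate delivers): there is ONE
periodic configuration P (the LJ-optimal hcp, 0 ∈ P) such that for every window radius R and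
tolerance ε, along every sequence of injective configurations x^N whose energy excess over the
ground-state energy is o(N), all but o(N) particles i admit a linear isometry A with the particles
in B_R(x_i) ε-matched both ways to x_i + A(P ∩ B_R). Mechanism: with an exact certificate the three
slacks Σ U(r_ij), E_g + cN, Σ_{i,j} f(x_i − x_j) of such a sequence are o(N); stability of the three
equality cases (near-Barlow ρ-environments at all but o(N) particles; pair distances on D_hcp;
structure factor on Bragg(hcp)) plus layer propagation and Hägg selection (shared 0737/0670) give
the matching. Specialised to ground states (excess 0) it is exactly BulkDefectVanish (0751). [deps:
ExactCertificate] [difficulty: XL] -/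
@[route_item "route-AtomisticToContinuum-CrystalThreeCone"]
def SlackRigidity : Prop :=
  ∃ P : Literature.MathematicalPhysics.StatisticalMechanics.PeriodicConfiguration 3, ∀ R ε : ℝ, 0 < R → 0 < ε → ∀ x : (N : ℕ) → (Fin N → EuclideanSpace ℝ (Fin 3)), (∀ N, Function.Injective (x N)) → Filter.Tendsto (fun N : ℕ => (Literature.MathematicalPhysics.StatisticalMechanics.interactionEnergy Literature.MathematicalPhysics.StatisticalMechanics.lennardJones (x N) - Literature.MathematicalPhysics.StatisticalMechanics.groundStateEnergy Literature.MathematicalPhysics.StatisticalMechanics.lennardJones 3 N) / N) Filter.atTop (nhds 0) → Filter.Tendsto (fun N : ℕ => (Nat.card {i : Fin N // ¬ ∃ A : EuclideanSpace ℝ (Fin 3) →ₗᵢ[ℝ] EuclideanSpace ℝ (Fin 3), (∀ p ∈ P.points, ‖p‖ ≤ R → ∃ j : Fin N, dist (x N j) (x N i + A p) ≤ ε) ∧ (∀ j : Fin N, dist (x N j) (x N i) ≤ R → ∃ p ∈ P.points, dist (x N j) (x N i + A p) ≤ ε)} : ℝ) / N) Filter.atTop (nhds 0)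

/-- item stmt-AtomisticToContinuum-0751 · support · rank 9 · open · by planner
sources: Hales2012, BlancLewin2015
[crux] HINGE: there is ONE periodic configuration P (the LJ-optimal HCP-type stacking, 0 ∈ motif)
such that for every window radius R and tolerance ε, in every sequence of LJ ground states all but
o(N) particles i admit a linear isometry A with the particles in B_R(x_i) ε-matched both ways to x_i
+ A(P.points ∩ B_R). Follows from (K1) SoftTwelveCoordination + (K2) RobustFejesTothHales + (K3)
stacking selection (Hägg domination 0716/0737 + certified J_k) with ≤ K fault planes per ground
state. Sources: Hales2012 Thm 1; HaggStacking.lean; PartayOrtnerCsanyi2017. -/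
@[route_item "route-AtomisticToContinuum-CrystalThreeCone"]
def BulkDefectVanish : Prop :=
  ∃ P : Literature.MathematicalPhysics.StatisticalMechanics.PeriodicConfiguration 3, ∀ R ε : ℝ, 0 < R → 0 < ε → ∀ x : (N : ℕ) → (Fin N → EuclideanSpace ℝ (Fin 3)), (∀ N, Literature.MathematicalPhysics.StatisticalMechanics.IsGroundState Literature.MathematicalPhysics.StatisticalMechanics.lennardJones (x N)) → Filter.Tendsto (fun N : ℕ => (Nat.card {i : Fin N // ¬ ∃ A : EuclideanSpace ℝ (Fin 3) →ₗᵢ[ℝ] EuclideanSpace ℝ (Fin 3), (∀ p ∈ P.points, ‖p‖ ≤ R → ∃ j : Fin N, dist (x N j) (x N i + A p) ≤ ε) ∧ (∀ j : Fin N, dist (x N j) (x N i) ≤ R → ∃ p ∈ P.points, dist (x N j) (x N i + A p) ≤ ε)} : ℝ) / N) Filter.atTop (nhds 0)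

/-- item stmt-AtomisticToContinuum-0752 · support · rank 9 · open · by planner
sources: BlancLewin2015
[support] SOFT ASSEMBLY LEMMA: BulkDefectVanish together with the uniform minimal distance of LJ
ground states (Literature fact LennardJonesMinimalDistance, Xue 1997 / BlancLewin2015 §2.2) implies
IsCrystallizing lennardJones 3: pick, for R_k = k, ε_k = 1/k, indices N_k ↑ and good particles i_k;
τ_k = −x_{i_k}; extract a convergent subsequence of the isometries A_k → A in O(3); minimal distance
+ discreteness of P make the ε-matching a local bijection, so Σ_i f(x_i + τ_k) → Σ_{s ∈ A(P.points)}
f(s) for f ∈ C_c; A(P) is again a PeriodicConfiguration (rotate lattice and motif), multiplicity m ≡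
1. -/
@[route_item "route-AtomisticToContinuum-CrystalThreeCone"]
def DefectVanishCrystallizes : Prop :=
  BulkDefectVanish → Literature.MathematicalPhysics.StatisticalMechanics.LennardJonesMinimalDistance → Literature.MathematicalPhysics.StatisticalMechanics.IsCrystallizing Literature.MathematicalPhysics.StatisticalMechanics.lennardJones 3

/-- item stmt-AtomisticToContinuum-3102 · support · rank 9 · closed · moot by None · by planner
sources: DelimaProcacciYuhjtman2015, Yuhjtman2015, BlancLewin2015
[support] KEPLER BOUND FOR LENNARD-JONES (finite-N energetic statement, the certificate's output
stripped of g, U, f): some periodic P has N·e(P) ≤ E_N(x) for every N and every configuration x of N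
distinct points — equivalently B_LJ = −e(P): the optimal stability constant is a periodic energy per
particle (expected 8.611 in ε-units = 0.7176 in tree units). A by-product other routes may want;
here it follows from ExactCertificate in ten lines (CertificateBound). [difficulty: open-problem] -/
@[route_item "route-AtomisticToContinuum-CrystalThreeCone"]
def KeplerBound : Prop :=
  ∃ P : Literature.MathematicalPhysics.StatisticalMechanics.PeriodicConfiguration 3, ∀ (N : ℕ) (x : Fin N → EuclideanSpace ℝ (Fin 3)), Function.Injective x → (N : ℝ) * P.energyPerParticle Literature.MathematicalPhysics.StatisticalMechanics.lennardJones ≤ Literature.MathematicalPhysics.StatisticalMechanics.interactionEnergy Literature.MathematicalPhysics.StatisticalMechanics.lennardJones x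

/-- item stmt-AtomisticToContinuum-3103 · support · rank 9 · closed · moot by None · by planner
sources: Ruelle1969
[support] glue: an exact certificate gives the Kepler bound — U-cone ≥ 0 termwise, the Bochner form
with w ≡ 1 gives 2Σ_{i<j} f ≥ −N f(0) (diagonal = f(0); two_mul_interactionEnergy_eq_sum_offDiag in
tree), g-stability gives Σ_{i<j} g ≥ −cN; add and use c + f(0)/2 = −e(P). [difficulty: provable-now] -/
@[route_item "route-AtomisticToContinuum-CrystalThreeCone"]
def CertificateBound : Prop :=
  ExactCertificate → KeplerBound

/-- item stmt-AtomisticToContinuum-3104 · support · rank 9 · closed · moot by None · by planner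
sources: BlancLewin2015
[support] TRIAL-STATE UPPER BOUND per periodic configuration: for every periodic Q and ε > 0,
eventually E(N)/N ≤ e(Q) + ε (finite blocks of Q as N-point trial states: boundary O(N^{2/3})
particles lose O(1) each since site energies are bounded by the summable r⁻⁶ tail,
hasSum_lennardJones_dist_three in tree). Implies 0629 (limsup ≤ ⨅) by le_ciInf without any BddBelow
hypothesis. [difficulty: M] -/
@[route_item "route-AtomisticToContinuum-CrystalThreeCone"]
def TrialStateUpper : Prop :=
  ∀ (Q : Literature.MathematicalPhysics.StatisticalMechanics.PeriodicConfiguration 3) (ε : ℝ), 0 < ε → ∀ᶠ N : ℕ in Filter.atTop, Literature.MathematicalPhysics.StatisticalMechanics.groundStateEnergy Literature.MathematicalPhysics.StatisticalMechanics.lennardJones 3 N / N ≤ Q.energyPerParticle Literature.MathematicalPhysics.StatisticalMechanics.lennardJones + ε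

/-- item stmt-AtomisticToContinuum-3105 · support · rank 9 · closed · moot by None · by planner
sources: BlancLewin2015
[support] glue: KeplerBound + TrialStateUpper ⇒ conjunct (i): from N e(P) ≤ E_N(x) get e(P) ≤ E(N)/N
for N ≥ 1 (le_ciInf over the non-empty injective configurations, nonempty_injective_config in tree);
with TrialStateUpper at Q = P, E(N)/N → e(P); at general Q, e(P) ≤ e(Q) + ε for all ε, so P IsLeast.
[difficulty: provable-now] -/
@[route_item "route-AtomisticToContinuum-CrystalThreeCone"]
def EnergeticHalf : Prop :=
  KeplerBound → TrialStateUpper → Literature.MathematicalPhysics.StatisticalMechanics.HasPeriodicGroundStateEnergy Literature.MathematicalPhysics.StatisticalMechanics.lennardJones 3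

/-- item stmt-AtomisticToContinuum-3106 · support · rank 9 · closed · moot by None · by planner
sources: BlancLewin2015
[support] glue (five lines, sorry-free in Sketch.lean): a ground state is injective with zero energy
excess, so SlackRigidity specialises to BulkDefectVanish. [difficulty: provable-now] -/
@[route_item "route-AtomisticToContinuum-CrystalThreeCone"]
def SlackToBulk : Prop :=
  SlackRigidity → BulkDefectVanish

/-- item stmt-AtomisticToContinuum-8332 · support · rank 9 · closed · moot by None · by planner
[support] glue, provable now (sorry-free candidate proof in the planner's Sketch95.lean, attached as
evidence): an exact three-cone certificate whose cut radius is at most 9/5 — ExactCertificate with ρ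
≤ 9/5 (NoGap's radius) inlined as the antecedent — together with TrialStateUpper gives NoGap with
the same (c, g, U, f) for every ε: g ≡ 0 beyond ρ ≤ 9/5, and TrialStateUpper at Q = P makes E(N)/N ≤
e(P) + ε = −(c + f(0)/2) + ε eventually, so some N ≥ 1 works. Off the Assembly chain (like NoGap
itself): it records in Lean in what sense NoGap is NECESSARY — refuting NoGap kills every exact
certificate within the design radius 9/5 (answer to refuter objection OBJ-3099; the radius policy —
dial 9/5→2→5/2 vs restating NoGap at the outer radius 5/2 with this glue's bound moved accordingly —
is a tenure decision, recommendation + ready edit.json attached as route evidence). [deps: NoGap,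
TrialStateUpper, ExactCertificate] [difficulty: provable-now] [sources: Ruelle1969, BlancLewin2015] -/
@[route_item "route-AtomisticToContinuum-CrystalThreeCone"]
def NoGapNecessary : Prop :=
  (∃ (P : Literature.MathematicalPhysics.StatisticalMechanics.PeriodicConfiguration 3) (ρ c : ℝ) (g U f : ℝ → ℝ), ρ ≤ 9 / 5 ∧ (∀ r : ℝ, 0 < r → Literature.MathematicalPhysics.StatisticalMechanics.lennardJones r = g r + U r + f r) ∧ (∀ r : ℝ, 0 < r → 0 ≤ U r) ∧ (∀ r : ℝ, ρ ≤ r → g r = 0) ∧ (∀ (n : ℕ) (y : Fin n → EuclideanSpace ℝ (Fin 3)) (w : Fin n → ℝ), 0 ≤ ∑ i, ∑ j, w i * w j * f (dist (y i) (y j))) ∧ (∀ (N : ℕ) (x : Fin N → EuclideanSpace ℝ (Fin 3)), Function.Injective x → -(c * (N : ℝ)) ≤ Literature.MathematicalPhysics.StatisticalMechanics.interactionEnergy g x) ∧ c + f 0 / 2 = -(P.energyPerParticle Literature.MathematicalPhysics.StatisticalMechanics.lennardJones)) → TrialStateUpper → NoGap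

/-- item stmt-AtomisticToContinuum-3107 · assembly · rank 1 · closed · moot by None · by planner
sources: BlancLewin2015
[assembly] ExactCertificate → SlackRigidity → CertificateBound → EnergeticHalf → TrialStateUpper →
SlackToBulk → DefectVanishCrystallizes → Crystallization. -/
@[route_item "route-AtomisticToContinuum-CrystalThreeCone"]
def Assembly : Prop :=
  ExactCertificate → SlackRigidity → CertificateBound → EnergeticHalf → TrialStateUpper → SlackToBulk → DefectVanishCrystallizes → Literature.MathematicalPhysics.StatisticalMechanics.Crystallization

end Summit.AtomisticToContinuum.Crystallization.Theses.CrystalThreeCone
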